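import Literature.MathematicalPhysics.QuantumFieldTheory.ConformalBootstrap3D.PointCertificateTableLower
import Literature.MathematicalPhysics.QuantumFieldTheory.ConformalBootstrap3D.PointCertificateTableUnboundedI

/-!
# Mixed-width point-functional tables: a per-cell `s`-cover (pub-ising3d CHECKER-SPEC-B″ §6)

The table theorems `boxExcluded_of_pointTable₂` (lower boxes) and
`boxExcluded_of_pointTable₂_unboundedC` (strips) carry ONE number per head cell and per (M) box,
valid for the whole `s`-width `[s_lo, s_hi]` of the box.  Near the LP-active points of a production
certificate the chord rule's `s`-decoupling loss at the full width exceeds the margin, while the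
same cell certifies on narrow `s`-pieces (pub-ising3d TABLECHECK R6/F9, kit j048527/j052180/
j052675).  This file proves the MIXED-WIDTH variants: every head cell `(ℓ, k)` and every (M) box
`(j, m)` carries its own monotone partition `s_lo = σ_0 ≤ σ_1 ≤ ⋯ ≤ σ_P = s_hi` (`P ≥ 1`) and one
number per piece; `P = 1` recovers the single-number tables.  The proof change is local: the
external dimension `s ∈ [s_lo, s_hi]` is first located in a piece (`exists_piece_Icc`), the cell /
box soundness lemma is applied on that piece, and the three full-width side conditions transfer to
sub-intervals — the node ratios `≥ 1/2` (`nodeRatios_of_width_le`, monotone in the width), the apex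
inequality (T) (`apexIneq_of_subbox`, `v^s`, `u^s` non-increasing in `s`) and rule (M) (a subset of
`Q`).

* `ruleM_of_boxTable_twist_scover` — rule (M) from an `s`-covered box table;
* `cell_of_headNumber₂_scover` — one two-bit head cell from its per-piece numbers;
* `boxExcluded_of_pointTable₂S` — the two-row LOWER-box table (`ε`-row + scalar/spinning rows,
  interval/monotone coefficient bit, corner/chord term bit), identity as a chord ROW, every head
  cell and (M) box `s`-covered;
* `boxExcluded_of_pointTable₂_unboundedS` — the same for STRIPS `Q ⊆ [s_lo, s_hi] × ([ε_lo, ε_hi) ∪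
  [t₀₀, ∞))`.

Term basis: Hogervorst–Rychkov 2013, §3 eq. (3.6)/(3.9). [cite: HogervorstRychkov2013, §3 eq. (3.9)]
-/

noncomputable section

namespace Literature.MathematicalPhysics.QuantumFieldTheory.ConformalBootstrap3D

open Finset Set

/-! ### Side conditions on a sub-interval of the `s`-width -/

/-- Node ratios `≥ 1/2` for the full width give them for any smaller width. [folklore] -/
theorem nodeRatios_of_width_le {N : ℕ} (z zb : Fin N → ℝ)
    (hz : ∀ k, z k ∈ Ioo (0 : ℝ) 1) (hzb : ∀ k, zb k ∈ Ioo (0 : ℝ) 1) {d d' : ℝ} (hle : d' ≤ d)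
    (hr : ∀ k, 1 / 2 ≤ ((1 - z k) * (1 - zb k)) ^ d ∧ 1 / 2 ≤ (z k * zb k) ^ d) :
    ∀ k, 1 / 2 ≤ ((1 - z k) * (1 - zb k)) ^ d' ∧ 1 / 2 ≤ (z k * zb k) ^ d' := by
  intro k
  have hzk := hz k; have hzbk := hzb k
  have hv0 : 0 < (1 - z k) * (1 - zb k) := mul_pos (by linarith [hzk.2]) (by linarith [hzbk.2])
  have hv1 : (1 - z k) * (1 - zb k) ≤ 1 := by nlinarith [hzk.1, hzbk.1, hzk.2, hzbk.2]
  have hu0 : 0 < z k * zb k := mul_pos hzk.1 hzbk.1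
  have hu1 : z k * zb k ≤ 1 := by nlinarith [hzk.1, hzbk.1, hzk.2, hzbk.2]
  exact ⟨half_le_rpow_of_le hv0 hv1 hle (hr k).1, half_le_rpow_of_le hu0 hu1 hle (hr k).2⟩

/-- The apex inequality (T) on `[s_lo, s_hi]` implies it on every sub-interval `[a, b]`
(`v^s`, `u^s` non-increasing in `s`, `0 ≤ w_a`). [folklore] -/
theorem apexIneq_of_subbox {N : ℕ} (w z zb : Fin N → ℝ)
    (hz : ∀ k, z k ∈ Ioo (0 : ℝ) 1) (hzb : ∀ k, zb k ∈ Ioo (0 : ℝ) 1) (a : Fin N) (ha : 0 ≤ w a)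
    (qd qr : Fin N → ℝ) (hqd : ∀ k, 0 ≤ qd k) (hqr : ∀ k, 0 ≤ qr k) {slo shi lo hi T : ℝ}
    (hlo : slo ≤ lo) (hhi : hi ≤ shi)
    (hB : ∑ k ∈ univ.erase a, |w k| * ((1 - z k) * (1 - zb k)) ^ slo * qd k ^ T
          + ∑ k, |w k| * (z k * zb k) ^ slo * qr k ^ T ≤ w a * ((1 - z a) * (1 - zb a)) ^ shi) :
    ∑ k ∈ univ.erase a, |w k| * ((1 - z k) * (1 - zb k)) ^ lo * qd k ^ T
        + ∑ k, |w k| * (z k * zb k) ^ lo * qr k ^ T ≤ w a * ((1 - z a) * (1 - zb a)) ^ hi := by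
  have hv : ∀ k, 0 < (1 - z k) * (1 - zb k) ∧ (1 - z k) * (1 - zb k) ≤ 1 := fun k =>
    ⟨mul_pos (by linarith [(hz k).2]) (by linarith [(hzb k).2]),
      mul_le_one₀ (by linarith [(hz k).1]) (by linarith [(hzb k).2]) (by linarith [(hzb k).1])⟩
  have hu : ∀ k, 0 < z k * zb k ∧ z k * zb k ≤ 1 := fun k =>
    ⟨mul_pos (hz k).1 (hzb k).1, mul_le_one₀ (hz k).2.le (hzb k).1.le (hzb k).2.le⟩
  have h1 : ∑ k ∈ univ.erase a, |w k| * ((1 - z k) * (1 - zb k)) ^ lo * qd k ^ T ≤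
      ∑ k ∈ univ.erase a, |w k| * ((1 - z k) * (1 - zb k)) ^ slo * qd k ^ T :=
    sum_le_sum fun k _ => mul_le_mul_of_nonneg_right
      (mul_le_mul_of_nonneg_left
        (Real.rpow_le_rpow_of_exponent_ge (hv k).1 (hv k).2 hlo) (abs_nonneg _))
      (Real.rpow_nonneg (hqd k) _)
  have h2 : ∑ k, |w k| * (z k * zb k) ^ lo * qr k ^ T ≤ ∑ k, |w k| * (z k * zb k) ^ slo * qr k ^ T :=
    sum_le_sum fun k _ => mul_le_mul_of_nonneg_right
      (mul_le_mul_of_nonneg_left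
        (Real.rpow_le_rpow_of_exponent_ge (hu k).1 (hu k).2 hlo) (abs_nonneg _))
      (Real.rpow_nonneg (hqr k) _)
  have h3 : w a * ((1 - z a) * (1 - zb a)) ^ shi ≤ w a * ((1 - z a) * (1 - zb a)) ^ hi :=
    mul_le_mul_of_nonneg_left (Real.rpow_le_rpow_of_exponent_ge (hv a).1 (hv a).2 hhi) ha
  linarith

/-- A piece of a monotone partition `σ_0 ≤ ⋯ ≤ σ_P` lies inside `[σ_0, σ_P]`, so its width is at
most the full width. [folklore] -/
theorem piece_bounds (σ : ℕ → ℝ) (P : ℕ) (hmono : ∀ i < P, σ i ≤ σ (i + 1)) {i : ℕ} (hi : i < P) :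
    σ 0 ≤ σ i ∧ σ (i + 1) ≤ σ P ∧ σ (i + 1) - σ i ≤ σ P - σ 0 := by
  have hb := piece_sub_of_monotone σ P hmono
  have h1 := (hb i hi.le).1
  have h2 := (hb (i + 1) (by omega)).2
  exact ⟨h1, h2, by linarith⟩

/-! ### Rule (M) from an `s`-covered box table -/

/-- **Rule (M) from an `s`-covered box table, twist-gap domain.** As `ruleM_of_boxTable_twist`, but
every box `(j, m)` carries a monotone partition `s_lo = σ_{j,m,0} ≤ ⋯ ≤ σ_{j,m,P} = s_hi`
(`P = eP j m ≥ 1`) and one `boxNumber ≥ 0` per piece. [cite: HogervorstRychkov2013, §3 eq. (3.6)] -/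
theorem ruleM_of_boxTable_twist_scover {N : ℕ} (w z zb : Fin N → ℝ)
    (hz : ∀ k, z k ∈ Ioo (0 : ℝ) 1) (hzb : ∀ k, zb k ∈ Ioo (0 : ℝ) 1)
    {Q : Set (ℝ × ℝ)} {slo shi E₀ ET : ℝ} (τ : ℝ) (hQ : ∀ p ∈ Q, slo ≤ p.1 ∧ p.1 ≤ shi)
    (hr : ∀ k, 1 / 2 ≤ ((1 - z k) * (1 - zb k)) ^ (shi - slo) ∧ 1 / 2 ≤ (z k * zb k) ^ (shi - slo))
    (e : ℕ → ℕ → ℝ) (M : ℕ → ℕ) (bc : ℕ → ℕ → Bool)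
    (he : ∀ j : ℕ, (j : ℝ) + τ < ET → e j 0 ≤ max E₀ ((j : ℝ) + τ) ∧ ET ≤ e j (M j))
    (hρ : ∀ j m, m < M j → bc j m = true → ∀ k, 1 / 2 ≤ (z k * zb k) ^ ((e j (m + 1) - e j m) / 2) ∧
      1 / 2 ≤ ((1 - z k) * (1 - zb k)) ^ ((e j (m + 1) - e j m) / 2))
    (eσ : ℕ → ℕ → ℕ → ℝ) (eP : ℕ → ℕ → ℕ)
    (heσ : ∀ j m, m < M j → 0 < eP j m ∧ eσ j m 0 = slo ∧ eσ j m (eP j m) = shi ∧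
      ∀ i < eP j m, eσ j m i ≤ eσ j m (i + 1))
    (hbox : ∀ j : ℕ, (j : ℝ) + τ < ET → ∀ m < M j, ∀ i < eP j m,
      0 ≤ boxNumber w z zb j (e j m) (e j (m + 1)) (eσ j m i) (eσ j m (i + 1)) (bc j m)) :
    ∀ (j : ℕ) (E : ℝ), E₀ ≤ E → E < ET → (j : ℝ) + τ ≤ E → ∀ p ∈ Q,
      0 ≤ pointFunctional w z zb (crossF p.1 (-1) (zMono E j)) := by
  intro j E hE0 hET hjE p hp
  have hjT : (j : ℝ) + τ < ET := lt_of_le_of_lt hjE hET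
  obtain ⟨he0, heM⟩ := he j hjT
  have hE : E ∈ Ico (e j 0) (e j (M j)) := ⟨he0.trans (max_le hE0 hjE), lt_of_lt_of_le hET heM⟩
  obtain ⟨m, hm, hEm⟩ := exists_cell_Ico (e j) (M j) E hE
  obtain ⟨hP, hσ0, hσP, hmono⟩ := heσ j m hm
  obtain ⟨i, hi, hsi⟩ := exists_piece_Icc (eσ j m) (eP j m) hP p.1
    ⟨hσ0 ▸ (hQ p hp).1, hσP ▸ (hQ p hp).2⟩
  have hwid : eσ j m (i + 1) - eσ j m i ≤ shi - slo := by
    have h := (piece_bounds (eσ j m) (eP j m) hmono hi).2.2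
    rwa [hσ0, hσP] at h
  have hri := nodeRatios_of_width_le z zb hz hzb hwid hr
  have hnum := hbox j hjT m hm i hi
  have hEc : E ∈ Icc (e j m) (e j (m + 1)) := ⟨hEm.1, hEm.2.le⟩
  cases hb : bc j m with
  | true =>
    rw [hb] at hnum; simp only [boxNumber, if_true] at hnum
    exact termwise_nonneg_of_chordMin w z zb hz hzb j hri (hρ j m hm hb) hnum E hEc p.1 hsi
  | false =>
    rw [hb] at hnum; simp only [boxNumber] at hnum
    exact termwise_nonneg_of_cornerBound w z zb hz hzb j (by simpa using hnum) E hEc p.1 hsi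

/-! ### One head cell from per-piece numbers -/

/-- **One two-bit head cell, `s`-covered.** As `cell_of_headNumber₂`, but the cell carries a
monotone partition `s_lo = σ_0 ≤ ⋯ ≤ σ_P = s_hi` (`P ≥ 1`) and `headNumber₂ ≥ 0` on every piece
`[σ_i, σ_{i+1}]`; rule (M) and the apex inequality are supplied for the full box and transferred
to the piece. [cite: HogervorstRychkov2013, §3 eq. (3.9)] -/
theorem cell_of_headNumber₂_scover {N : ℕ} (w z zb : Fin N → ℝ)
    (hz : ∀ k, z k ∈ Ioo (0 : ℝ) 1) (hzb : ∀ k, zb k ∈ Ioo (0 : ℝ) 1) (hord : ∀ k, zb k ≤ z k)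
    (apex : Fin N) (hapex : 0 ≤ w apex) (qd qr : Fin N → ℝ) (hqd : ∀ k, 0 < qd k ∧ qd k ≤ 1)
    (hqr : ∀ k, 0 < qr k ∧ qr k ≤ 1)
    (hdomd : ∀ k, z k * zb k ≤ qd k ^ 2 * (z apex * zb apex) ∧ z k ≤ qd k * z apex)
    (hdomr : ∀ k, (1 - z k) * (1 - zb k) ≤ qr k ^ 2 * (z apex * zb apex) ∧
      1 - zb k ≤ qr k * z apex)
    {Q : Set (ℝ × ℝ)} {slo shi E₀ ET τ : ℝ} (hQ : ∀ p ∈ Q, slo ≤ p.1 ∧ p.1 ≤ shi) (hτ1 : τ ≤ 1)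
    (hM : ∀ (j : ℕ) (E : ℝ), E₀ ≤ E → E < ET → (j : ℝ) + τ ≤ E → ∀ p ∈ Q,
      0 ≤ pointFunctional w z zb (crossF p.1 (-1) (zMono E j)))
    (hB : ∑ k ∈ univ.erase apex, |w k| * ((1 - z k) * (1 - zb k)) ^ slo * qd k ^ ET
          + ∑ k, |w k| * (z k * zb k) ^ slo * qr k ^ ET ≤
          w apex * ((1 - z apex) * (1 - zb apex)) ^ shi)
    (hr : ∀ k, 1 / 2 ≤ ((1 - z k) * (1 - zb k)) ^ (shi - slo) ∧ 1 / 2 ≤ (z k * zb k) ^ (shi - slo))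
    {ℓ : ℕ} {a b : ℝ} (nF : ℕ) (hnF : E₀ ≤ a + ((nF : ℝ) + 1)) (useChord useInterval : Bool)
    (h1 : useInterval = false → (ℓ : ℝ) + 1 ≤ a)
    (h2 : useInterval = true → unitarityBound3D ℓ < a ∧ (ℓ : ℝ) + τ ≤ a)
    (hρ : useChord = true → ∀ k, 1 / 2 ≤ (z k * zb k) ^ ((b - a) / 2) ∧
      1 / 2 ≤ ((1 - z k) * (1 - zb k)) ^ ((b - a) / 2))
    (σ : ℕ → ℝ) (P : ℕ) (hP : 0 < P) (hσ0 : σ 0 = slo) (hσP : σ P = shi)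
    (hmono : ∀ i < P, σ i ≤ σ (i + 1))
    (hnum : ∀ i < P, 0 ≤ headNumber₂ w z zb ℓ a b (σ i) (σ (i + 1)) nF useChord useInterval) :
    ∀ p ∈ Q, ∀ Δ ∈ Ico a b, BlockPositive (pointFunctional w z zb) p.1 Δ ℓ := by
  intro p hp Δ hΔ
  obtain ⟨i, hi, hsi⟩ := exists_piece_Icc σ P hP p.1 ⟨hσ0 ▸ (hQ p hp).1, hσP ▸ (hQ p hp).2⟩
  obtain ⟨hlo, hhi, hwid⟩ := piece_bounds σ P hmono hi
  rw [hσ0] at hlo; rw [hσP] at hhi; rw [hσ0, hσP] at hwid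
  have hri := nodeRatios_of_width_le z zb hz hzb hwid hr
  have hBi := apexIneq_of_subbox w z zb hz hzb apex hapex qd qr (fun k => (hqd k).1.le)
    (fun k => (hqr k).1.le) (T := ET) hlo hhi hB
  -- apply the single-number cell theorem on the piece, to the one-point box `{p}`
  have hQi : ∀ q ∈ ({p} : Set (ℝ × ℝ)), σ i ≤ q.1 ∧ q.1 ≤ σ (i + 1) := by
    intro q hq
    rw [Set.mem_singleton_iff] at hq
    rw [hq]
    exact ⟨hsi.1, hsi.2⟩
  have hMi : ∀ (j : ℕ) (E : ℝ), E₀ ≤ E → E < ET → (j : ℝ) + τ ≤ E → ∀ q ∈ ({p} : Set (ℝ × ℝ)),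
      0 ≤ pointFunctional w z zb (crossF q.1 (-1) (zMono E j)) := by
    intro j E hE0 hET hjE q hq
    rw [Set.mem_singleton_iff] at hq
    rw [hq]
    exact hM j E hE0 hET hjE p hp
  exact cell_of_headNumber₂ w z zb hz hzb hord apex hapex qd qr hqd hqr hdomd hdomr hQi hτ1 hMi hBi
    hri nF hnF useChord useInterval h1 h2 hρ (hnum i hi) p (Set.mem_singleton p) Δ hΔ

/-! ### The mixed-width two-row tables -/

/-- **The two-row LOWER-box table, mixed width (every head cell and (M) box `s`-covered), identity
as a chord row.** Data and checks of `boxExcluded_of_pointTable₂` with three changes: (O1) is a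
chord ROW (a monotone partition `s_lo = σI_0 ≤ ⋯ ≤ σI_{K_I} = s_hi`, `K_I ≥ 1`, with
`0 < termChordMin w z z̄ 0 σI_i σI_{i+1} 0 0` per piece); every head cell `(ℓ, k)` of the scalar /
spinning rows (resp. `k` of the `ε`-row) carries a monotone partition `σ ℓ k 0 = s_lo, …,
σ ℓ k (P ℓ k) = s_hi` (resp. `σε k`, `Pε k`), `P ≥ 1`, and `headNumber₂ ≥ 0` on EVERY piece; every
(M) box `(j, m)` likewise (`eσ j m`, `eP j m`, `boxNumber ≥ 0` per piece).  `P ≡ 1` is the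
single-number table.  CONCLUSION: `BoxExcluded Q` for
`Q ⊆ [s_lo, s_hi] × ([ε_lo, ε_hi) ∪ [t₀₀, E₀))`. [cite: HogervorstRychkov2013, §3 eq. (3.6)] -/
theorem boxExcluded_of_pointTable₂S {N : ℕ} {w z zb : Fin N → ℝ}
    (hz : ∀ k, z k ∈ Ioo (0 : ℝ) 1) (hzb : ∀ k, zb k ∈ Ioo (0 : ℝ) 1) (hord : ∀ k, zb k ≤ z k)
    (apex : Fin N) (hapex : 0 ≤ w apex) (qd qr : Fin N → ℝ) (hqd : ∀ k, 0 < qd k ∧ qd k ≤ 1)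
    (hqr : ∀ k, 0 < qr k ∧ qr k ≤ 1)
    (hdomd : ∀ k, z k * zb k ≤ qd k ^ 2 * (z apex * zb apex) ∧ z k ≤ qd k * z apex)
    (hdomr : ∀ k, (1 - z k) * (1 - zb k) ≤ qr k ^ 2 * (z apex * zb apex) ∧
      1 - zb k ≤ qr k * z apex)
    {Q : Set (ℝ × ℝ)} {slo shi εlo εhi E₀ ET τ : ℝ}
    (t : ℕ → ℕ → ℝ) (K : ℕ → ℕ) (nF : ℕ → ℕ → ℕ) (hc hi : ℕ → ℕ → Bool)
    (tε : ℕ → ℝ) (Kε : ℕ) (nFε : ℕ → ℕ) (hcε hiε : ℕ → Bool)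
    (hQ : ∀ p ∈ Q, (slo ≤ p.1 ∧ p.1 ≤ shi) ∧
      ((εlo ≤ p.2 ∧ p.2 < εhi) ∨ (t 0 0 ≤ p.2 ∧ p.2 < E₀)))
    (L : ℕ) (hL : E₀ ≤ (L : ℝ) + 1) (hτ1 : τ ≤ 1) (hτ0 : τ ≤ E₀)
    (hr : ∀ k, 1 / 2 ≤ ((1 - z k) * (1 - zb k)) ^ (shi - slo) ∧ 1 / 2 ≤ (z k * zb k) ^ (shi - slo))
    -- (O1) as a chord row
    (σI : ℕ → ℝ) (KI : ℕ) (hKI : 0 < KI) (hσI0 : σI 0 = slo) (hσIK : σI KI = shi)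
    (hσImono : ∀ i < KI, σI i ≤ σI (i + 1))
    (hIrow : ∀ i < KI, 0 < termChordMin w z zb 0 (σI i) (σI (i + 1)) 0 0)
    -- the ε-row (ℓ = 0), s-covered
    (htε : tε 0 = εlo ∧ tε Kε = εhi)
    (hlowε1 : ∀ k, k < Kε → hiε k = false → 1 ≤ tε k)
    (hlowεI : ∀ k, k < Kε → hiε k = true → 1 / 2 < tε k ∧ τ ≤ tε k)
    (hnFε : ∀ k, k < Kε → E₀ ≤ tε k + ((nFε k : ℝ) + 1))
    (hρε : ∀ k, k < Kε → hcε k = true → ∀ i, 1 / 2 ≤ (z i * zb i) ^ ((tε (k + 1) - tε k) / 2) ∧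
      1 / 2 ≤ ((1 - z i) * (1 - zb i)) ^ ((tε (k + 1) - tε k) / 2))
    (σε : ℕ → ℕ → ℝ) (Pε : ℕ → ℕ)
    (hσε : ∀ k < Kε, 0 < Pε k ∧ σε k 0 = slo ∧ σε k (Pε k) = shi ∧
      ∀ i < Pε k, σε k i ≤ σε k (i + 1))
    (hheadε : ∀ k < Kε, ∀ i < Pε k,
      0 ≤ headNumber₂ w z zb 0 (tε k) (tε (k + 1)) (σε k i) (σε k (i + 1)) (nFε k) (hcε k) (hiε k))
    -- the scalar row (ℓ = 0, from ≤ 3 to E₀) and the spinning rows, s-covered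
    (ht0 : t 0 0 ≤ 3 ∧ t 0 (K 0) = E₀)
    (htℓ : ∀ ℓ, Even ℓ → ℓ ≠ 0 → ℓ < L → t ℓ 0 = (ℓ : ℝ) + 1 ∧ t ℓ (K ℓ) = E₀)
    (hlow1 : ∀ ℓ k, k < K ℓ → hi ℓ k = false → (ℓ : ℝ) + 1 ≤ t ℓ k)
    (hlowI : ∀ ℓ k, k < K ℓ → hi ℓ k = true → unitarityBound3D ℓ < t ℓ k ∧ (ℓ : ℝ) + τ ≤ t ℓ k)
    (hnF : ∀ ℓ k, k < K ℓ → E₀ ≤ t ℓ k + ((nF ℓ k : ℝ) + 1))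
    (hρ : ∀ ℓ k, k < K ℓ → hc ℓ k = true → ∀ i, 1 / 2 ≤ (z i * zb i) ^ ((t ℓ (k + 1) - t ℓ k) / 2) ∧
      1 / 2 ≤ ((1 - z i) * (1 - zb i)) ^ ((t ℓ (k + 1) - t ℓ k) / 2))
    (σ : ℕ → ℕ → ℕ → ℝ) (P : ℕ → ℕ → ℕ)
    (hσ : ∀ ℓ k, k < K ℓ → 0 < P ℓ k ∧ σ ℓ k 0 = slo ∧ σ ℓ k (P ℓ k) = shi ∧
      ∀ i < P ℓ k, σ ℓ k i ≤ σ ℓ k (i + 1))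
    (hhead : ∀ ℓ, (ℓ = 0 ∨ (Even ℓ ∧ ℓ < L)) → ∀ k < K ℓ, ∀ i < P ℓ k,
      0 ≤ headNumber₂ w z zb ℓ (t ℓ k) (t ℓ (k + 1)) (σ ℓ k i) (σ ℓ k (i + 1)) (nF ℓ k)
        (hc ℓ k) (hi ℓ k))
    -- (M) box rows, twist-gap domain, s-covered
    (e : ℕ → ℕ → ℝ) (M : ℕ → ℕ) (bc : ℕ → ℕ → Bool)
    (he : ∀ j : ℕ, (j : ℝ) + τ < ET → e j 0 ≤ max E₀ ((j : ℝ) + τ) ∧ ET ≤ e j (M j))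
    (hρM : ∀ j m, m < M j → bc j m = true → ∀ k, 1 / 2 ≤ (z k * zb k) ^ ((e j (m + 1) - e j m) / 2) ∧
      1 / 2 ≤ ((1 - z k) * (1 - zb k)) ^ ((e j (m + 1) - e j m) / 2))
    (eσ : ℕ → ℕ → ℕ → ℝ) (eP : ℕ → ℕ → ℕ)
    (heσ : ∀ j m, m < M j → 0 < eP j m ∧ eσ j m 0 = slo ∧ eσ j m (eP j m) = shi ∧
      ∀ i < eP j m, eσ j m i ≤ eσ j m (i + 1))
    (hbox : ∀ j : ℕ, (j : ℝ) + τ < ET → ∀ m < M j, ∀ i < eP j m,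
      0 ≤ boxNumber w z zb j (e j m) (e j (m + 1)) (eσ j m i) (eσ j m (i + 1)) (bc j m))
    -- (T)
    (hB : ∑ k ∈ univ.erase apex, |w k| * ((1 - z k) * (1 - zb k)) ^ slo * qd k ^ ET
          + ∑ k, |w k| * (z k * zb k) ^ slo * qr k ^ ET ≤
          w apex * ((1 - z apex) * (1 - zb apex)) ^ shi) :
    BoxExcluded Q := by
  have hQ1 : ∀ p ∈ Q, slo ≤ p.1 ∧ p.1 ≤ shi := fun p hp => (hQ p hp).1
  have hM := ruleM_of_boxTable_twist_scover w z zb hz hzb τ hQ1 hr e M bc he hρM eσ eP heσ hbox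
  -- every cell of the scalar and spinning rows
  have hcell : ∀ ℓ, (ℓ = 0 ∨ (Even ℓ ∧ ℓ < L)) → ∀ k < K ℓ, ∀ p ∈ Q,
      ∀ Δ ∈ Ico (t ℓ k) (t ℓ (k + 1)), BlockPositive (pointFunctional w z zb) p.1 Δ ℓ :=
    fun ℓ hℓ k hk => cell_of_headNumber₂_scover w z zb hz hzb hord apex hapex qd qr hqd hqr hdomd
      hdomr hQ1 hτ1 hM hB hr (nF ℓ k) (hnF ℓ k hk) (hc ℓ k) (hi ℓ k) (hlow1 ℓ k hk) (hlowI ℓ k hk)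
      (hρ ℓ k hk) (σ ℓ k) (P ℓ k) (hσ ℓ k hk).1 (hσ ℓ k hk).2.1 (hσ ℓ k hk).2.2.1
      (hσ ℓ k hk).2.2.2 (hhead ℓ hℓ k hk)
  -- every cell of the ε-row
  have hb0 : unitarityBound3D 0 = 1 / 2 := by simp [unitarityBound3D]
  have hcellε : ∀ k < Kε, ∀ p ∈ Q,
      ∀ Δ ∈ Ico (tε k) (tε (k + 1)), BlockPositive (pointFunctional w z zb) p.1 Δ 0 :=
    fun k hk => cell_of_headNumber₂_scover w z zb hz hzb hord apex hapex qd qr hqd hqr hdomd hdomr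
      hQ1 hτ1 hM hB hr (nFε k) (hnFε k hk) (hcε k) (hiε k)
      (fun h => by simpa using hlowε1 k hk h)
      (fun h => by
        obtain ⟨h1, h2⟩ := hlowεI k hk h
        exact ⟨by rw [hb0]; exact h1, by simpa using h2⟩)
      (hρε k hk) (σε k) (Pε k) (hσε k hk).1 (hσε k hk).2.1 (hσε k hk).2.2.1 (hσε k hk).2.2.2
      (hheadε k hk)
  refine boxExcluded_of_pointRules_twistI hz hzb hord apex hapex qd qr hqd hqr hdomd hdomr hQ1 hτ1 hτ0
    (fun p hp => identity_pos_of_chordRow w z zb hz hzb hr σI KI hKI hσI0 hσIK hσImono hIrow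
      ⟨(hQ p hp).1.1, (hQ p hp).1.2⟩) ?_ ?_ ?_ hM hB
  · -- (O2): `Δ_ε` lies in the ε-row or in the scalar row
    intro p hp
    rcases (hQ p hp).2 with hε | h0
    · exact blockPositive_of_cells_Ico tε Kε hcellε p hp p.2 ⟨htε.1 ▸ hε.1, htε.2 ▸ hε.2⟩
    · exact blockPositive_of_cells_Ico (t 0) (K 0) (hcell 0 (Or.inl rfl)) p hp p.2
        ⟨h0.1, ht0.2 ▸ h0.2⟩
  · -- (O3)
    exact scalar_nonneg_of_cells (t 0) (K 0) ht0.1 ht0.2 (hcell 0 (Or.inl rfl))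
  · -- (O4)
    exact spinning_nonneg_of_cells L hL t K (fun ℓ hev hℓ hℓL => (htℓ ℓ hev hℓ hℓL).1.le)
      (fun ℓ hev hℓ hℓL => (htℓ ℓ hev hℓ hℓL).2)
      (fun ℓ hev hℓ hℓL => hcell ℓ (Or.inr ⟨hev, hℓL⟩))

/-- **The two-row STRIP table, mixed width, identity as a chord row.** Data and checks of
`boxExcluded_of_pointTable₂_unboundedC` (`Q ⊆ [s_lo, s_hi] × ([ε_lo, ε_hi) ∪ [t₀₀, ∞))`,
`E₀ ≥ 1/2`) with every head cell and every (M) box `s`-covered as in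
`boxExcluded_of_pointTable₂S`. [cite: HogervorstRychkov2013, §3 eq. (3.6)] -/
theorem boxExcluded_of_pointTable₂_unboundedS {N : ℕ} {w z zb : Fin N → ℝ}
    (hz : ∀ k, z k ∈ Ioo (0 : ℝ) 1) (hzb : ∀ k, zb k ∈ Ioo (0 : ℝ) 1) (hord : ∀ k, zb k ≤ z k)
    (apex : Fin N) (hapex : 0 ≤ w apex) (qd qr : Fin N → ℝ) (hqd : ∀ k, 0 < qd k ∧ qd k ≤ 1)
    (hqr : ∀ k, 0 < qr k ∧ qr k ≤ 1)
    (hdomd : ∀ k, z k * zb k ≤ qd k ^ 2 * (z apex * zb apex) ∧ z k ≤ qd k * z apex)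
    (hdomr : ∀ k, (1 - z k) * (1 - zb k) ≤ qr k ^ 2 * (z apex * zb apex) ∧
      1 - zb k ≤ qr k * z apex)
    {Q : Set (ℝ × ℝ)} {slo shi εlo εhi E₀ ET τ : ℝ}
    (t : ℕ → ℕ → ℝ) (K : ℕ → ℕ) (nF : ℕ → ℕ → ℕ) (hc hi : ℕ → ℕ → Bool)
    (tε : ℕ → ℝ) (Kε : ℕ) (nFε : ℕ → ℕ) (hcε hiε : ℕ → Bool)
    (hQ : ∀ p ∈ Q, (slo ≤ p.1 ∧ p.1 ≤ shi) ∧ ((εlo ≤ p.2 ∧ p.2 < εhi) ∨ t 0 0 ≤ p.2))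
    (L : ℕ) (hL : E₀ ≤ (L : ℝ) + 1) (hτ1 : τ ≤ 1) (hτ0 : τ ≤ E₀) (hE0 : 1 / 2 ≤ E₀)
    (hr : ∀ k, 1 / 2 ≤ ((1 - z k) * (1 - zb k)) ^ (shi - slo) ∧ 1 / 2 ≤ (z k * zb k) ^ (shi - slo))
    -- (O1) as a chord row
    (σI : ℕ → ℝ) (KI : ℕ) (hKI : 0 < KI) (hσI0 : σI 0 = slo) (hσIK : σI KI = shi)
    (hσImono : ∀ i < KI, σI i ≤ σI (i + 1))
    (hIrow : ∀ i < KI, 0 < termChordMin w z zb 0 (σI i) (σI (i + 1)) 0 0)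
    -- the ε-row (ℓ = 0), s-covered
    (htε : tε 0 = εlo ∧ tε Kε = εhi)
    (hlowε1 : ∀ k, k < Kε → hiε k = false → 1 ≤ tε k)
    (hlowεI : ∀ k, k < Kε → hiε k = true → 1 / 2 < tε k ∧ τ ≤ tε k)
    (hnFε : ∀ k, k < Kε → E₀ ≤ tε k + ((nFε k : ℝ) + 1))
    (hρε : ∀ k, k < Kε → hcε k = true → ∀ i, 1 / 2 ≤ (z i * zb i) ^ ((tε (k + 1) - tε k) / 2) ∧
      1 / 2 ≤ ((1 - z i) * (1 - zb i)) ^ ((tε (k + 1) - tε k) / 2))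
    (σε : ℕ → ℕ → ℝ) (Pε : ℕ → ℕ)
    (hσε : ∀ k < Kε, 0 < Pε k ∧ σε k 0 = slo ∧ σε k (Pε k) = shi ∧
      ∀ i < Pε k, σε k i ≤ σε k (i + 1))
    (hheadε : ∀ k < Kε, ∀ i < Pε k,
      0 ≤ headNumber₂ w z zb 0 (tε k) (tε (k + 1)) (σε k i) (σε k (i + 1)) (nFε k) (hcε k) (hiε k))
    -- the scalar row and the spinning rows, s-covered
    (ht0 : t 0 0 ≤ 3 ∧ t 0 (K 0) = E₀)
    (htℓ : ∀ ℓ, Even ℓ → ℓ ≠ 0 → ℓ < L → t ℓ 0 = (ℓ : ℝ) + 1 ∧ t ℓ (K ℓ) = E₀)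
    (hlow1 : ∀ ℓ k, k < K ℓ → hi ℓ k = false → (ℓ : ℝ) + 1 ≤ t ℓ k)
    (hlowI : ∀ ℓ k, k < K ℓ → hi ℓ k = true → unitarityBound3D ℓ < t ℓ k ∧ (ℓ : ℝ) + τ ≤ t ℓ k)
    (hnF : ∀ ℓ k, k < K ℓ → E₀ ≤ t ℓ k + ((nF ℓ k : ℝ) + 1))
    (hρ : ∀ ℓ k, k < K ℓ → hc ℓ k = true → ∀ i, 1 / 2 ≤ (z i * zb i) ^ ((t ℓ (k + 1) - t ℓ k) / 2) ∧
      1 / 2 ≤ ((1 - z i) * (1 - zb i)) ^ ((t ℓ (k + 1) - t ℓ k) / 2))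
    (σ : ℕ → ℕ → ℕ → ℝ) (P : ℕ → ℕ → ℕ)
    (hσ : ∀ ℓ k, k < K ℓ → 0 < P ℓ k ∧ σ ℓ k 0 = slo ∧ σ ℓ k (P ℓ k) = shi ∧
      ∀ i < P ℓ k, σ ℓ k i ≤ σ ℓ k (i + 1))
    (hhead : ∀ ℓ, (ℓ = 0 ∨ (Even ℓ ∧ ℓ < L)) → ∀ k < K ℓ, ∀ i < P ℓ k,
      0 ≤ headNumber₂ w z zb ℓ (t ℓ k) (t ℓ (k + 1)) (σ ℓ k i) (σ ℓ k (i + 1)) (nF ℓ k)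
        (hc ℓ k) (hi ℓ k))
    -- (M) box rows, twist-gap domain, s-covered
    (e : ℕ → ℕ → ℝ) (M : ℕ → ℕ) (bc : ℕ → ℕ → Bool)
    (he : ∀ j : ℕ, (j : ℝ) + τ < ET → e j 0 ≤ max E₀ ((j : ℝ) + τ) ∧ ET ≤ e j (M j))
    (hρM : ∀ j m, m < M j → bc j m = true → ∀ k, 1 / 2 ≤ (z k * zb k) ^ ((e j (m + 1) - e j m) / 2) ∧
      1 / 2 ≤ ((1 - z k) * (1 - zb k)) ^ ((e j (m + 1) - e j m) / 2))
    (eσ : ℕ → ℕ → ℕ → ℝ) (eP : ℕ → ℕ → ℕ)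
    (heσ : ∀ j m, m < M j → 0 < eP j m ∧ eσ j m 0 = slo ∧ eσ j m (eP j m) = shi ∧
      ∀ i < eP j m, eσ j m i ≤ eσ j m (i + 1))
    (hbox : ∀ j : ℕ, (j : ℝ) + τ < ET → ∀ m < M j, ∀ i < eP j m,
      0 ≤ boxNumber w z zb j (e j m) (e j (m + 1)) (eσ j m i) (eσ j m (i + 1)) (bc j m))
    -- (T)
    (hB : ∑ k ∈ univ.erase apex, |w k| * ((1 - z k) * (1 - zb k)) ^ slo * qd k ^ ET
          + ∑ k, |w k| * (z k * zb k) ^ slo * qr k ^ ET ≤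
          w apex * ((1 - z apex) * (1 - zb apex)) ^ shi) :
    BoxExcluded Q := by
  have hQ1 : ∀ p ∈ Q, slo ≤ p.1 ∧ p.1 ≤ shi := fun p hp => (hQ p hp).1
  have hM := ruleM_of_boxTable_twist_scover w z zb hz hzb τ hQ1 hr e M bc he hρM eσ eP heσ hbox
  have hcell : ∀ ℓ, (ℓ = 0 ∨ (Even ℓ ∧ ℓ < L)) → ∀ k < K ℓ, ∀ p ∈ Q,
      ∀ Δ ∈ Ico (t ℓ k) (t ℓ (k + 1)), BlockPositive (pointFunctional w z zb) p.1 Δ ℓ :=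
    fun ℓ hℓ k hk => cell_of_headNumber₂_scover w z zb hz hzb hord apex hapex qd qr hqd hqr hdomd
      hdomr hQ1 hτ1 hM hB hr (nF ℓ k) (hnF ℓ k hk) (hc ℓ k) (hi ℓ k) (hlow1 ℓ k hk) (hlowI ℓ k hk)
      (hρ ℓ k hk) (σ ℓ k) (P ℓ k) (hσ ℓ k hk).1 (hσ ℓ k hk).2.1 (hσ ℓ k hk).2.2.1
      (hσ ℓ k hk).2.2.2 (hhead ℓ hℓ k hk)
  have hb0 : unitarityBound3D 0 = 1 / 2 := by simp [unitarityBound3D]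
  have hcellε : ∀ k < Kε, ∀ p ∈ Q,
      ∀ Δ ∈ Ico (tε k) (tε (k + 1)), BlockPositive (pointFunctional w z zb) p.1 Δ 0 :=
    fun k hk => cell_of_headNumber₂_scover w z zb hz hzb hord apex hapex qd qr hqd hqr hdomd hdomr
      hQ1 hτ1 hM hB hr (nFε k) (hnFε k hk) (hcε k) (hiε k)
      (fun h => by simpa using hlowε1 k hk h)
      (fun h => by
        obtain ⟨h1, h2⟩ := hlowεI k hk h
        exact ⟨by rw [hb0]; exact h1, by simpa using h2⟩)
      (hρε k hk) (σε k) (Pε k) (hσε k hk).1 (hσε k hk).2.1 (hσε k hk).2.2.1 (hσε k hk).2.2.2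
      (hheadε k hk)
  refine boxExcluded_of_pointRules_twist_unboundedI hz hzb hord apex hapex qd qr hqd hqr hdomd hdomr
    hQ1 hτ1 hτ0 hE0
    (fun p hp => identity_pos_of_chordRow w z zb hz hzb hr σI KI hKI hσI0 hσIK hσImono hIrow
      ⟨(hQ p hp).1.1, (hQ p hp).1.2⟩) ?_ ?_ ?_ hM hB
  · -- (O2) below E₀: ε-row or scalar row
    intro p hp hlt
    rcases (hQ p hp).2 with hε | h0
    · exact blockPositive_of_cells_Ico tε Kε hcellε p hp p.2 ⟨htε.1 ▸ hε.1, htε.2 ▸ hε.2⟩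
    · exact blockPositive_of_cells_Ico (t 0) (K 0) (hcell 0 (Or.inl rfl)) p hp p.2
        ⟨h0, ht0.2 ▸ hlt⟩
  · exact scalar_nonneg_of_cells (t 0) (K 0) ht0.1 ht0.2 (hcell 0 (Or.inl rfl))
  · exact spinning_nonneg_of_cells L hL t K (fun ℓ hev hℓ hℓL => (htℓ ℓ hev hℓ hℓL).1.le)
      (fun ℓ hev hℓ hℓL => (htℓ ℓ hev hℓ hℓL).2)
      (fun ℓ hev hℓ hℓL => hcell ℓ (Or.inr ⟨hev, hℓL⟩))

end Literature.MathematicalPhysics.QuantumFieldTheory.ConformalBootstrap3D
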